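import Summits.Schanuel.Schanuel.Theorems.RootDecomp1KArcCell03

/-!
# RootDecomp1KArcCell — lens 1, generation 50, node 9 «THE ARC ENGINE: separation by positive-dimensional containment; members ρ° = Π(1+4^(−k!)) and the twin σ° = Π(1+2·4^(−k!)); item 33364 decided hyp-free at zA = (1, ℓ₂, ρ°), zD = (1, ρ°, σ°) and π-twins» — continuation (RootDecomp1KArcCell04): §4b psQ, the link to the tree's TruncGeneric and (X′) re-derived

(lens-1 g50 HOME kernel K = HOME/decomp-schanuel-lens-1/g50/ArcCell.lean 10f1e0d5…, 3410 l · 258 decl lines, imports …RootDecomp1KCollarWall05 + …RootDecomp1KCommonRadixCell04 + …RootDecomp1KNWMeasureHolds BY NAME; P ArcCellProbe.lean af7624ff… rc 0 / C₀ ArcCellCtrl0.lean d71f613e… rc 0 / C ArcCellCtrl.lean 242a3b02… rc 1 = 42 planted; memo NODE-g50.md; CLAIM L2466, EX-ANTE PRICE + CHECKLIST K-g50 L2467, NODE L2469 / REQUEST L2470 (with the lens's ex-post self-correction: both members fall to printed dominance in substance — zA directly by Bundschuh LNM 1415 p.78 / Zhu 推论 1.3.3, zD after τ = σ°/ρ°²);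 critic VERDICT L2473: CLEARED AS PRICED EX ANTE — ONE CELL ×1 «ARC CELL (TYPED-LEVEL)» with the SUBSTANCE CAVEAT OF RECORD (both members inside the archimedean dominance class in substance; E2 convenient, not necessary), RULE K-R39 FIXED, PORT GO. Port by census-1 gen 21 as `RootDecomp1KArcCell01–13` along K's §1–§12 with §4, §7 and §12 cut at decl boundaries by the 400-line file cap: 01 = §1 (E1) `aeval_one_div_two_pow_ne_zero` (dyadic root lemma) + §2 (E2) `toPolyPoly`, `arc_count` (a relation contains ≤ deg q of an injective family of rational arcs — roots over the domain ℚ[X]); 02 = §3 (A) the member: `dfac`, `arcNum`, `arcProdQ` (ρ°_N), `sQ`, `rhoArc` (ρ° = Π(1 + 4^(−k!))) and its tails; 03 = §4a (E3) `TruncGenericSeq` («[class] definition» tag) + **`algebraicIndependent_of_truncGenericSeq`** (the g36/g37 extraction re-plumbed to arbitrary dyadic-type schedules); 04 = §4b `psQ`, the link `truncGeneric_iff_truncGenericSeq` and the tree (X′) re-derived — K's `theorem algebraicIndependent_liouville_of_truncGeneric'` DEMOTED to a documented `example` (its statement is byte-identical to the tree's `RootDecomp1KCommonRadixCell.algebraicIndependent_liouville_of_truncGeneric`,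 CommonRadixCell03 l.98 — dedup twin flagged by the writer L2472 (α), demotion pre-sanctioned by the critic L2473; nothing in K uses the primed name); 05 = §5 the arcs of ρ°: `arcPoly`, `arcF`, `arcBasis`, `arcScal`, `clearArc`, `truncGenericSeq_arc`, tightness `qArc` / `qArc_tight`; 06 = §6 the arc cell `algebraicIndependent_arc_of_mvPolyMeasure`, `algebraicIndependent_rhoArc_ell2`, walls `sb_arcWall3(_pi)`, item-shape instances + §7 head `zA` / `zApi`, `linearIndependent_zA(pi)`, `linLiouville_zA(pi)`; 07 = §7a the ONE 2-adic cut `cutA` + **`form_lower_bound_A`** (exponent 9), `not_hyperLinLiouville_zA(pi)` (m₀ = 10), `sb_zA(pi)`, `finiteOrderLiouvilleSchanuel_at_zA(pi)`, `item33364_at_zA(pi)`, `item31077_at_zA`; 08 = §8 `rhoArc_position` (11 conjuncts by tree name) and its lemmas, `liouville_rhoArc`; 09 = §9 (A′) the twin σ° = Π(1 + 2·4^(−k!)): `arcNum2`, `arcOdd2`, `arcProdQ2`, `sigmaArc`, `liouville_sigmaArc`; 10 = §10 the lines of (ρ°, σ°): `linPoly`, `linF`, `linBasis`, `linScal`, `clearLin`,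 `truncGenericSeq_lin`, `qLin` / `qLin_tight`; 11 = §11 the twin cell `algebraicIndependent_twin_of_mvPolyMeasure`, walls `sb_twinWall3(_pi)`, item-shape instances + §12 head `zD` / `zDpi`, binders; 12 = §12a part 1 the archimedean two-level cut `cutD`, `cutD_succ_ne_zero`, `cutD_height_bound`; 13 = §12a part 2 **`form_lower_bound_D`** (exponent 7), `not_hyperLinLiouville_zD(pi)` (m₀ = 8), `sb_zD(pi)`, `item33364_at_zD(pi)`, `zD_shape`. PORT EDITS (census convention): `set_option linter.dupNamespace false` dropped; 77 one-line helper docstrings added (statements quoted); per-part private helper copies; sections `Extraction` / `Members` / `TwinMembers` closed and re-opened across the cuts with their `variable` / `open` lines; statements and proofs otherwise verbatim (no renames; K's own private markers kept). `--supports stmt-Schanuel-33364`; no census credit carried; rung 0 — nothing here proves Schanuel; no ∀-item moves; 33364, 33363, 31077 stay OPEN.)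
-/

noncomputable section

open Polynomial LiouvilleNumber
open scoped Nat

namespace Summit.Schanuel.Schanuel.Theorems.RootDecomp1KArcCell

open Summit.Schanuel.Schanuel.Theorems.RootDecomp1KCollarCell
open Summit.Schanuel.Schanuel.Theorems.RootDecomp1KGapCell
open Summit.Schanuel.Schanuel.Theorems.RootDecomp1KTwoBaseCell
open Summit.Schanuel.Schanuel.Theorems.RootDecomp1KRelLiouvilleCell
open Summit.Schanuel.Schanuel.Theorems.RootDecomp1KNWMeasureHolds (polyMeasure_exp_one_holds)
open Summit.Schanuel.Schanuel.Theorems.RootDecomp1KHyper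
open Summit.Schanuel.Schanuel.Theorems.RootDecomp1KHyper.HyperCell
open Summit.Schanuel.Schanuel.Theorems.RootDecomp1KCommonRadixCell (TruncGeneric algebraicIndependent_liouville_of_truncGeneric)

section Extraction

variable {k n : ℕ}

/-- The rational partial sums `s_b(N) = psNumer b N / b^{N!}` of the standard Liouville number `ℓ_b` (tree TwoBaseCell06
`psNumer`, `partialSum_eq_psNumer_div`). -/
def psQ (b N : ℕ) : ℚ := (psNumer b N : ℚ) / (b : ℚ) ^ N !

/-- `{b : ℕ} (hb : 0 < b) (N : ℕ) : ((psQ b N : ℚ) : ℝ) = partialSum (b : ℝ) N`. -/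
theorem psQ_cast {b : ℕ} (hb : 0 < b) (N : ℕ) : ((psQ b N : ℚ) : ℝ) = partialSum (b : ℝ) N := by
  rw [partialSum_eq_psNumer_div hb N, psQ]; push_cast; rfl

/-- Cast of the evaluation at the rational partial sums `psQ (b i) N` to `ℝ` equals the evaluation at `partialSum (b i) N`. -/
theorem aeval_psQ_cast {b : Fin k → ℕ} (hb : ∀ i, 0 < b i) (q : MvPolynomial (Fin k) ℤ) (N : ℕ) :
    ((MvPolynomial.aeval (fun i => psQ (b i) N) q : ℚ) : ℝ) =
      MvPolynomial.aeval (fun i => partialSum (b i : ℝ) N) q := by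
  rw [← Rat.coe_castHom, map_aeval_int]
  have hw : (fun i => (Rat.castHom ℝ) (psQ (b i) N)) = fun i => partialSum (b i : ℝ) N :=
    funext fun i => by rw [Rat.coe_castHom, psQ_cast (hb i)]
  rw [hw]

/-- **LINK LEMMA.**  Tree CommonRadixCell03 `TruncGeneric b` (real partial sums of `ℓ_{b_i}`) IS `TruncGenericSeq` of
the rational partial-sum sequence `(psQ (b i))_i`. -/
theorem truncGeneric_iff_truncGenericSeq {b : Fin k → ℕ} (hb : ∀ i, 0 < b i) :
    TruncGeneric b ↔ TruncGenericSeq (fun i => psQ (b i)) := by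
  refine forall_congr' fun q => forall_congr' fun _ => forall_congr' fun N₀ => exists_congr fun N =>
    and_congr_right fun _ => ?_
  rw [← aeval_psQ_cast hb q N, ne_eq, ne_eq, Rat.cast_eq_zero]

/-- **(X′) RE-DERIVED, STATEMENT VERBATIM** (tree CommonRadixCell03 `algebraicIndependent_liouville_of_truncGeneric`)
from (E3) + the link lemma, for ALL bases `b_i ≥ 2` (denominators `b_i^{N!} ≤ 2^{(Σ b)·N!}`, `|s| < 2`, error
`≤ 2/2^{(N+1)!}` by tree MeasuredWallCell03 `abs_liouvilleNumber_sub_partialSum_le`): (E3) is a generalisation of the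
tree engine, not a parallel one. -/
example {b : Fin k → ℕ} (hb : ∀ i, 2 ≤ b i)
    (hnv : TruncGeneric b) {θ : Fin n → ℂ} (hθ : MvPolyMeasure θ) :
    AlgebraicIndependent ℚ
      (Sum.elim (fun i => ((liouvilleNumber (b i) : ℝ) : ℂ)) θ : Fin k ⊕ Fin n → ℂ) := by
  have hb0 : ∀ i, 0 < b i := fun i => by have := hb i; omega
  refine algebraicIndependent_of_truncGenericSeq (ξ := fun i => liouvilleNumber (b i : ℝ))
    (x := fun i => psQ (b i)) (A := ∑ i, b i) (B := 2) (c := 2) (by norm_num) (by norm_num)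
    ?_ ?_ ?_ ((truncGeneric_iff_truncGenericSeq hb0).mp hnv) hθ
  · intro i N
    show (psQ (b i) N).den ≤ 2 ^ ((∑ i, b i) * N !)
    have h1 : (psQ (b i) N).den ≤ b i ^ N ! := by
      have hd := Rat.den_dvd (psNumer (b i) N : ℤ) ((b i : ℤ) ^ N !)
      rw [Rat.divInt_eq_div] at hd
      push_cast at hd
      have hpos : (0 : ℤ) < (b i : ℤ) ^ N ! := by have := hb0 i; positivity
      have h2 := Int.le_of_dvd hpos hd
      rw [psQ]; exact_mod_cast h2
    refine h1.trans ?_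
    have h3 : b i ≤ 2 ^ ∑ j, b j :=
      Nat.lt_two_pow_self.le.trans (Nat.pow_le_pow_right two_pos
        (Finset.single_le_sum (f := fun j => b j) (fun _ _ => Nat.zero_le _) (Finset.mem_univ i)))
    calc b i ^ N ! ≤ (2 ^ ∑ j, b j) ^ N ! := Nat.pow_le_pow_left h3 _
      _ = 2 ^ ((∑ j, b j) * N !) := by rw [← pow_mul]
  · intro i N
    show |((psQ (b i) N : ℚ) : ℝ)| ≤ 2
    rw [psQ_cast (hb0 i)]
    have h2 : (2 : ℝ) ≤ (b i : ℝ) := by exact_mod_cast hb i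
    rw [abs_of_pos (partialSum_pos' (by linarith) N)]
    exact (partialSum_lt_two h2 N).le
  · intro i N
    show |liouvilleNumber (b i : ℝ) - ((psQ (b i) N : ℚ) : ℝ)| ≤ 2 / 2 ^ (N + 1)!
    rw [psQ_cast (hb0 i)]
    exact Summit.Schanuel.Schanuel.Theorems.RootDecomp1KMeasuredWallCell.abs_liouvilleNumber_sub_partialSum_le
      (by exact_mod_cast hb i) N

end Extraction

end Summit.Schanuel.Schanuel.Theorems.RootDecomp1KArcCell

end
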